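import Summits.Ventures.CertifiedArithmetic.LowPrec.DoubleRoundingProductStripFineZones
import Summits.Ventures.CertifiedArithmetic.LowPrec.DoubleRoundingProductStripFineTable
import Summits.Ventures.CertifiedArithmetic.LowPrec.DoubleRoundingProductStripFine

/-!
# Double rounding of products on the fine strip: `(P, P_ψ) = (3, 5)` is innocuous from `d = 4` on,
# and the complete decision of the strip at a finer quantum

HONEST FRAMING (venture CertifiedArithmetic / cell `pub-lowprec`): certified error envelopes and
provably optimal rounding/accumulation schemes for low-precision formats under stated cost models;
every table by two implementations; no hardware or vendor claims.

Setting: `x = a·b` exact, `a, b` data of `φ` (`m = m_φ ≥ 1`, `P = m + 1`, quantum `q`), a register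
`ψ` holding every value of `φ` (`embedsTest`) in the PRECISION STRIP `m + 1 ≤ m_ψ ≤ 2m` with a
FINER quantum `q_ψ = q / 2^d`, `d ≥ 1`; `DRMul φ ψ` = "`fl_φ ∘ fl_ψ = fl_φ` on all products".
§1 THE ENGINE (`drMul_of_mulFineHit_eq_false`): for `d ≥ m + 2`, no hit of the table
`mulFineHit (m+1) m_ψ (min d (2m+1))` (`DoubleRoundingProductStripFineTable.lean`) ⟹ `DRMul`:
a product `K·2^E·q` (`K` = product of the odd parts, `2^G ≤ K < 2^(G+1)`) is saturated, zero, a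
value of `ψ`, or slips only through a two-grid window of one of the three zones of
`DoubleRoundingProductStripFineZones.lean` (normal cell = FAR, `[c, c+1]·q` = LOW, `[0, q]` =
BOTTOM), each a hit of the table; the clamp `min d (2m+1)` is exact (FAR is `d`-free, LOW with a
coarse register grid is `d`-free and stays coarse at `d = 2m+1` because `m_ψ ≤ 2m`, LOW with the
full register grid forces `d ≤ 2m`, BOTTOM depends on `min m_ψ (d-1) = m_ψ` there).
§2 THE LAW (P1) `drMul_fine_three_five`: `m_φ = 2`, `m_ψ = 4`, `L_ψ + 4 ≤ L_φ`, `F_φ ⊆ F_ψ`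
`⟹ DRMul φ ψ` — every record, no range hypothesis (kernel: `mulFineHit 3 4 {4,5} = false`).
§3 THE DECISION OF THE FINE STRIP `drMul_fine_strip_iff`: for every embedded pair in the strip with
`d ≥ 1`, depth `bias_φ ≥ m + 3`, headroom `2^(m + bias + 1) ≤ M_φ` (`maxRat φ ≥ 4`), `bias_ψ ≥ 1`:
`DRMul φ ψ ↔ (m_φ, m_ψ) = (2, 4) ∧ d ≥ 4` — assembled from THEOREM N-mul-S (`not_drMul_strip`,
`m ≥ 3`), N-mul-U (`not_drMul_of_underflow`, `d ≤ m + 1`), the families (W9) (`(2,3)`, `d ≥ 3`)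
and (W21) (`(3,4)`, `d ≥ 2`) of `DoubleRoundingProductStripFine.lean`, and P1.  With the equal-
quantum decision `drMul_sameQ_strip_iff` (`d = 0`: `DRMul ↔ m ≤ 2`) and the law of the fat strip
`P_ψ ≥ 2P` (`drMul_iff_mulLawTest`) this completes the decision of `DRMul` for every embedded
pair of records with a more precise register, up to the stated depth/headroom side conditions.
Two implementations: A = `code/enum/mul_strip_fine_table.py` → C45 (the engine's statement
replayed by brute force on 490 pseudo-record rows, 0 violations) and `mul_strip_fine_law.py` → C44
(the truth table of the strip; `(3,5)`: `DRMul ↔ d ≥ 4` on deep rows); B = this file (structural).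
PLACEMENT — KNOWN: innocuous double rounding of products needs `p₂ ≥ 2p₁` with unbounded exponents
and is characterised through midpoints ([Figueroa1995, §3]; [MartinDorelMelquiondMuller2013,
Property 2.1, Thm 4.1]; [Rump2016, Lemma 4.5]: for `p₁ ≤ 3` no unbounded-exponent counterexample,
the first one is `13² → p₂ = 5, 6, 7` at `p₁ = 4`); formats with both subnormal ranges in play are
treated case by case in print ([Roux2014, Table II] for binary64/binary32-style pairs).  We found
no statement deciding a register of intermediate precision `p₁ < p₂ < 2p₁` with a finer `emin` by
`(p₁, p₂, emin gap)`; searches in `pub-lowprec-enum/FRESHNESS-ENUM.md` (gen27–28).  NEW (modestly):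
the decision; its only innocuous cell `(3, 5)`, `d ≥ 4`, is a gradual-underflow phenomenon of the
register (at `d ≤ 3` it slips by N-mul-U).  No hardware or vendor claims.
-/

namespace Summit.Ventures.CertifiedArithmetic

open Literature.ComputerArithmetic.FloatingPoint
open Literature.ComputerArithmetic.FloatingPoint.Format
open Literature.ComputerArithmetic.FloatingPoint.MiniFloat

/-! ## §1 The engine: no hit of the fine table, no slip -/

/-- NO FINE HIT, NO SLIP — for EVERY pair of records with `F_φ ⊆ F_ψ` (`embedsTest`),
`m = m_φ ≥ 1`, `m + 1 ≤ m_ψ ≤ 2m`, `d = L_φ - L_ψ ≥ m + 2`: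
`mulFineHit (m+1) m_ψ (min d (2m+1)) = false ⟹ DRMul φ ψ`. [this packet] -/
theorem drMul_of_mulFineHit_eq_false {φ ψ : Format} (hE : embedsTest φ ψ = true)
    (h1 : 1 ≤ φ.manBits) (hP : φ.manBits + 1 ≤ ψ.manBits) (hP2 : ψ.manBits ≤ 2 * φ.manBits)
    (hdm : φ.manBits + 2 ≤ (φ.qexp - ψ.qexp).toNat)
    (hhit : mulFineHit (φ.manBits + 1) ψ.manBits
      (min (φ.qexp - ψ.qexp).toNat (2 * φ.manBits + 1)) = false) : DRMul φ ψ := by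
  have htop := exists_toRat_eq_maxRat_of_test hE
  have hemb := embeds_of_test hE
  simp only [embedsTest, Bool.and_eq_true, decide_eq_true_eq] at hE
  obtain ⟨⟨-, hq'⟩, hMM⟩ := hE
  have hmax := (maxRat_le_maxRat_iff hq').2 hMM
  have hQ := quantum_eq_two_pow_mul hq'
  obtain ⟨d, hd'⟩ : ∃ d, (φ.qexp - ψ.qexp).toNat = d := ⟨_, rfl⟩
  rw [hd'] at hMM hdm hhit hQ
  have hd : φ.qexp = ψ.qexp + d := by omega
  have h1ψ : 1 ≤ ψ.manBits := by omega
  obtain ⟨d', hd''⟩ : ∃ d', min d (2 * φ.manBits + 1) = d' := ⟨_, rfl⟩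
  rw [hd''] at hhit
  have hd'd : d' = d ∨ (d' = 2 * φ.manBits + 1 ∧ 2 * φ.manBits + 2 ≤ d) := by omega
  intro a b
  rcases le_or_gt φ.maxRat |a.toRat * b.toRat| with hsat | hlt
  · exact toRat_roundNE_roundNE_of_maxRat_le_abs htop hsat
  have hltM : |a.toRat * b.toRat| < (φ.maxScaled : ℚ) * φ.quantum := hlt
  have habs := abs_toRat_mul_toRat a b
  by_cases h0 : a.scaledMag * b.scaledMag = 0
  · have hx0 : a.toRat * b.toRat = 0 := abs_eq_zero.mp (by rw [habs, h0]; simp)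
    rw [hx0]; exact toRat_roundNE_roundNE_of_exists ⟨zero ψ, toRat_zero⟩
  obtain ⟨ha0, hb0⟩ := mul_ne_zero_iff.mp h0
  obtain ⟨oa, ja, hoa, hoa', hsa⟩ := exists_odd_mul_two_pow a ha0
  obtain ⟨ob, jb, hob, hob', hsb⟩ := exists_odd_mul_two_pow b hb0
  have hK2 : oa * ob < 2 ^ (2 * φ.manBits + 2) := by
    calc oa * ob < 2 ^ (φ.manBits + 1) * 2 ^ (φ.manBits + 1) :=
          Nat.mul_lt_mul_of_lt_of_le hoa' hob'.le (by positivity)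
      _ = 2 ^ (2 * φ.manBits + 2) := by rw [← pow_add]; congr 1; omega
  have hK0 : oa * ob ≠ 0 := by
    intro h; rcases mul_eq_zero.mp h with h' | h' <;> omega
  -- `|a·b| = K · 2^E · q`, `K = oa·ob`, `E = ja + jb + L_φ`, `2^G ≤ K < 2^(G+1)`
  obtain ⟨E, hE_def⟩ : ∃ E : ℤ, ((ja + jb : ℕ) : ℤ) + φ.qexp = E := ⟨_, rfl⟩
  have h2E : (2 : ℚ) ^ E * 2 ^ φ.qexp = (2 : ℚ) ^ (ja + jb) * 2 ^ (φ.qexp + φ.qexp) := by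
    rw [← zpow_natCast, ← zpow_add₀ two_ne_zero, ← zpow_add₀ two_ne_zero]
    congr 1; push_cast; omega
  have habs' : |a.toRat * b.toRat| = ((oa * ob : ℕ) : ℚ) * (2 : ℚ) ^ E * φ.quantum := by
    rw [habs, hsa, hsb]; unfold Format.quantum
    rw [mul_assoc (((oa * ob : ℕ)) : ℚ), h2E]; push_cast; ring
  obtain ⟨G, hG'⟩ : ∃ G, Nat.log 2 (oa * ob) = G := ⟨_, rfl⟩
  have hGle : 2 ^ G ≤ oa * ob := hG' ▸ Nat.pow_log_le_self 2 hK0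
  have hGlt : oa * ob < 2 ^ (G + 1) := hG' ▸ Nat.lt_pow_succ_log_self (by norm_num) _
  have hG2 : G ≤ 2 * φ.manBits + 1 := by
    by_contra h
    have := Nat.pow_le_pow_right (n := 2) (by norm_num) (show 2 * φ.manBits + 2 ≤ G by omega)
    omega
  have hGP : G < 2 * (φ.manBits + 1) := by omega
  -- (i) a value of `ψ`
  by_cases hex : 0 ≤ E + d ∧ G ≤ ψ.manBits
  · obtain ⟨hE0, hGψ⟩ := hex
    have hKψ : oa * ob < 2 ^ (ψ.manBits + 1) :=
      lt_of_lt_of_le hGlt (Nat.pow_le_pow_right (by norm_num) (by omega))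
    have hxE : |a.toRat * b.toRat| = ((oa * ob * 2 ^ (E + d).toNat : ℕ) : ℚ) * ψ.quantum := by
      rw [habs', hQ]; push_cast
      rw [← zpow_natCast (2 : ℚ) (E + d).toNat, Int.toNat_of_nonneg hE0,
        zpow_add₀ two_ne_zero, zpow_natCast]
      ring
    refine toRat_roundNE_roundNE_of_exists
      (exists_toRat_eq_of_abs_eq_natMul (representable_mul_pow hKψ ?_) hxE)
    have h' : ((oa * ob * 2 ^ (E + d).toNat : ℕ) : ℚ) * ψ.quantum
        < (ψ.maxScaled : ℚ) * ψ.quantum := by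
      rw [← hxE]; exact lt_of_lt_of_le hlt hmax
    exact_mod_cast (lt_of_mul_lt_mul_right h' ψ.quantum_pos.le).le
  have hnot1 : 0 ≤ E + d → ψ.manBits + 1 ≤ G := fun h => by by_contra h'; exact hex ⟨h, by omega⟩
  by_contra hne
  have hne' : (roundNE φ (roundNE ψ |a.toRat * b.toRat|).toRat).toRat
      ≠ (roundNE φ |a.toRat * b.toRat|).toRat :=
    fun h => hne (toRat_roundNE_roundNE_of_abs h)
  by_cases hlz : (G : ℤ) + E ≤ φ.manBits
  · -- (ii) the low zones (`E = -u < 0`): `x = K q / 2^u`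
    have hE0 : E < 0 := by
      by_contra h
      have := hnot1 (by omega)
      omega
    obtain ⟨u, hu'⟩ : ∃ u : ℕ, (-E).toNat = u := ⟨_, rfl⟩
    obtain ⟨hu, hEu⟩ : 1 ≤ u ∧ E = -(u : ℤ) := ⟨by omega, by omega⟩
    have hxu : |a.toRat * b.toRat| = ((oa * ob : ℕ) : ℚ) * φ.quantum / 2 ^ u := by
      rw [habs', hEu, zpow_neg, zpow_natCast]; ring
    obtain ⟨c, hc'⟩ : ∃ c, oa * ob / 2 ^ u = c := ⟨_, rfl⟩
    obtain ⟨r, hr'⟩ : ∃ r, oa * ob % 2 ^ u = r := ⟨_, rfl⟩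
    obtain ⟨hKcr, hrK⟩ := (Nat.div_mod_unique (a := oa * ob) (b := 2 ^ u) (c := r) (d := c)
      (by positivity)).mp ⟨hc', hr'⟩
    have hKcr' : oa * ob = c * 2 ^ u + r := by rw [← hKcr]; ring
    have hcu : c < 2 ^ (φ.manBits + 1) := by
      rw [← hc', Nat.div_lt_iff_lt_mul (by positivity), ← pow_add]
      exact lt_of_lt_of_le hGlt (Nat.pow_le_pow_right (by norm_num) (by omega))
    have hcM : c < φ.maxScaled := by
      have h1' : ((c : ℕ) : ℚ) * φ.quantum ≤ ((oa * ob : ℕ) : ℚ) * φ.quantum / 2 ^ u := by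
        rw [hKcr', le_div_iff₀ (by positivity)]; push_cast
        have : (0 : ℚ) ≤ (r : ℚ) * φ.quantum := mul_nonneg (Nat.cast_nonneg _) φ.quantum_pos.le
        nlinarith [φ.quantum_pos, pow_pos (two_pos : (0 : ℚ) < 2) u]
      have hlt2 := hltM
      rw [hxu] at hlt2
      have h2' := lt_of_le_of_lt h1' hlt2
      exact_mod_cast lt_of_mul_lt_mul_right h2' φ.quantum_pos.le
    -- (ii-a) the register holds `x` (`u ≤ d`, `G ≤ m_ψ`)
    by_cases hreg : u ≤ d ∧ G ≤ ψ.manBits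
    · obtain ⟨hud, hGψ⟩ := hreg
      have hKψ : oa * ob < 2 ^ (ψ.manBits + 1) :=
        lt_of_lt_of_le hGlt (Nat.pow_le_pow_right (by norm_num) (by omega))
      obtain ⟨e, he⟩ : ∃ e, d = u + e := ⟨d - u, by omega⟩
      have hxE : |a.toRat * b.toRat| = ((oa * ob * 2 ^ e : ℕ) : ℚ) * ψ.quantum := by
        rw [hxu, hQ, he, pow_add, div_eq_iff (by positivity)]; push_cast; ring
      refine hne (toRat_roundNE_roundNE_of_exists
        (exists_toRat_eq_of_abs_eq_natMul (representable_mul_pow hKψ ?_) hxE))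
      have h' : ((oa * ob * 2 ^ e : ℕ) : ℚ) * ψ.quantum < (ψ.maxScaled : ℚ) * ψ.quantum := by
        rw [← hxE]; exact lt_of_lt_of_le hlt hmax
      exact_mod_cast (lt_of_mul_lt_mul_right h' ψ.quantum_pos.le).le
    rw [hxu] at hne'
    rcases Nat.eq_zero_or_pos c with hc0 | hc1
    · -- (ii-c) BOTTOM: `c = 0`, `K < 2^u`, the cell `[0, q]`
      have hKu : oa * ob < 2 ^ u := by
        rw [← hc', Nat.div_eq_zero_iff] at hc0
        rcases hc0 with h | h
        · exact absurd h (by positivity)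
        · exact h
      have hGu : G + 1 ≤ u := by
        by_contra h
        have := Nat.pow_le_pow_right (n := 2) (by norm_num) (show u ≤ G by omega)
        omega
      have hmn : 2 + min ψ.manBits (d - 1) ≤ u := by
        by_contra h
        exact hreg ⟨by omega, by omega⟩
      have h1M : 1 ≤ φ.maxScaled := by omega
      have hwin := fine_bottom_window_of_roundNE_roundNE_ne hd h1 h1ψ (u := u)
        (w := d - 1 - min ψ.manBits (d - 1)) (g := u - 2 - min ψ.manBits (d - 1))
        (r := oa * ob) (by omega) (by omega) hKu h1M
        (Nat.pow_le_pow_right (by norm_num) (by omega))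
        (le_trans (by simpa using Nat.mul_le_mul_right (2 ^ d) h1M) hMM) hne'
      obtain ⟨hlo, hhi⟩ := hwin
      rcases Nat.lt_or_ge (G + 1) u with hG1 | hG1
      · have := Nat.pow_le_pow_right (n := 2) (by norm_num) (show G + 1 ≤ u - 1 by omega)
        omega
      have huG : u = G + 1 := by omega
      have hAt := mulFineWinAt_of_window (T := True) (c := 0) (t := u)
        (g := u - 2 - min ψ.manBits (d - 1)) (K := oa * ob) (r := oa * ob) (by ring) hKu
        (Or.inl ⟨rfl, hlo, by
          rcases lt_or_eq_of_le hhi with h | h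
          · exact Or.inl h
          · exact Or.inr ⟨trivial, h⟩⟩)
      have hmn' : min ψ.manBits (d' - 1) = min ψ.manBits (d - 1) := by omega
      have := mulFineHit_of_bottom (P := φ.manBits + 1) (mψ := ψ.manBits) (d := d') hoa hoa'
        hob hob' hGP hGle hGlt (by rw [hmn']; omega)
        (by rw [hmn', ← huG]; simpa using hAt)
      rw [hhit] at this
      exact Bool.false_ne_true this
    · -- (ii-b) LOW: `c ≥ 1`, the cell `[c, c+1]·q`, register grid `2^w q_ψ`
      have huG : u ≤ G := by
        by_contra h
        have : oa * ob < 2 ^ u :=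
          lt_of_lt_of_le hGlt (Nat.pow_le_pow_right (by norm_num) (by omega))
        rw [← hc', Nat.div_eq_of_lt this] at hc1
        exact lt_irrefl 0 hc1
      have hcG : c < 2 ^ (G + 1 - u) := by
        rw [← hc', Nat.div_lt_iff_lt_mul (by positivity), ← pow_add,
          show G + 1 - u + u = G + 1 by omega]
        exact hGlt
      have hcGe : 2 ^ (G - u) ≤ c := by
        rw [← hc', Nat.le_div_iff_mul_le (by positivity), ← pow_add,
          show G - u + u = G by omega]
        exact hGle
      obtain ⟨w, hw'⟩ : ∃ w, G - u + d - ψ.manBits = w := ⟨_, rfl⟩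
      have hdw : d + 1 ≤ w + u := by
        by_contra h
        exact hreg ⟨by omega, by omega⟩
      obtain ⟨w', hw''⟩ : ∃ w', G - u + d' - ψ.manBits = w' := ⟨_, rfl⟩
      have hww : w' + d = w + d' := by omega
      have hψm : (c + 1) * 2 ^ d ≤ 2 ^ (ψ.manBits + 1 + w) :=
        calc (c + 1) * 2 ^ d ≤ 2 ^ (G + 1 - u) * 2 ^ d := Nat.mul_le_mul_right _ hcG
          _ = 2 ^ (G + 1 - u + d) := by rw [← pow_add]
          _ ≤ 2 ^ (ψ.manBits + 1 + w) := Nat.pow_le_pow_right (by norm_num) (by omega)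
      have hψM : (c + 1) * 2 ^ d ≤ ψ.maxScaled :=
        le_trans (Nat.mul_le_mul_right _ (by omega)) hMM
      have hψe : 1 ≤ w → 2 ^ (ψ.manBits + w) ≤ c * 2 ^ d := fun h1w => by
        rw [show ψ.manBits + w = (G - u) + d by omega, pow_add 2 (G - u) d]
        exact Nat.mul_le_mul_right _ hcGe
      rw [hKcr'] at hne'
      have hwin := fine_low_window_of_roundNE_roundNE_ne hd h1 h1ψ (u := u) (w := w)
        (g := w' + u - d' - 1) (c := c) (r := r) hu (by omega) (by omega) hrK hc1 hcu
        (by omega) hψm hψM hψe hne'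
      simp only [show (w + 2 ≤ d) ↔ (w' + 2 ≤ d') from ⟨fun h => by omega, fun h => by omega⟩]
        at hwin
      have hAt := mulFineWinAt_of_window (T := w' + 2 ≤ d') hKcr' hrK hwin
      have := mulFineHit_of_low (P := φ.manBits + 1) (mψ := ψ.manBits) (d := d') hoa hoa'
        hob hob' hGP hGle hGlt hu huG (by omega) hw'' (by omega) hAt
      rw [hhit] at this
      exact Bool.false_ne_true this
  -- (iii) FAR: a normal cell `[c, c+1]·2^(k+1) q`, `K = c·2^t + r`, `t = G - m`, `k + 1 = E + t`
  have hEd : 0 ≤ E + d := by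
    by_contra h
    omega
  have hGψ : ψ.manBits + 1 ≤ G := hnot1 hEd
  obtain ⟨δ, hδ⟩ : ∃ δ, ψ.manBits = φ.manBits + δ := ⟨ψ.manBits - φ.manBits, by omega⟩
  obtain ⟨t, ht'⟩ : ∃ t, G - φ.manBits = t := ⟨_, rfl⟩
  have hGt : G = φ.manBits + t := by omega
  obtain ⟨k, hk'⟩ : ∃ k : ℕ, (E + t - 1).toNat = k := ⟨_, rfl⟩
  have hk : (k : ℤ) + 1 = E + t := by omega
  obtain ⟨c, hc'⟩ : ∃ c, oa * ob / 2 ^ t = c := ⟨_, rfl⟩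
  obtain ⟨r, hr'⟩ : ∃ r, oa * ob % 2 ^ t = r := ⟨_, rfl⟩
  obtain ⟨hKcr, hrK⟩ := (Nat.div_mod_unique (a := oa * ob) (b := 2 ^ t) (c := r) (d := c)
    (by positivity)).mp ⟨hc', hr'⟩
  have hKcr' : oa * ob = c * 2 ^ t + r := by rw [← hKcr]; ring
  have hclo : 2 ^ φ.manBits ≤ c := by
    rw [← hc', Nat.le_div_iff_mul_le (by positivity), ← pow_add, ← hGt]; exact hGle
  have hchi : c < 2 ^ (φ.manBits + 1) := by
    rw [← hc', Nat.div_lt_iff_lt_mul (by positivity), ← pow_add,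
      show φ.manBits + 1 + t = G + 1 by omega]
    exact hGlt
  have h2E' : (2 : ℚ) ^ E = 2 ^ (k + 1) / 2 ^ t := by
    rw [eq_div_iff (by positivity), ← zpow_natCast, ← zpow_natCast, ← zpow_add₀ two_ne_zero]
    congr 1; push_cast; omega
  have hxc : |a.toRat * b.toRat|
      = ((c * 2 ^ t + r : ℕ) : ℚ) * φ.quantum * 2 ^ (k + 1) / 2 ^ t := by
    rw [habs', hKcr', h2E']; ring
  rw [hxc] at hne' hltM
  have hcM : (c + 1) * 2 ^ (k + 1) ≤ φ.maxScaled := by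
    refine succ_mul_pow_le_maxScaled hclo hchi ?_
    have h1' : ((c * 2 ^ (k + 1) : ℕ) : ℚ) * φ.quantum
        ≤ ((c * 2 ^ t + r : ℕ) : ℚ) * φ.quantum * 2 ^ (k + 1) / 2 ^ t := by
      rw [le_div_iff₀ (by positivity)]; push_cast
      have : (0 : ℚ) ≤ (r : ℚ) * φ.quantum * 2 ^ (k + 1) :=
        mul_nonneg (mul_nonneg (Nat.cast_nonneg _) φ.quantum_pos.le) (by positivity)
      nlinarith [φ.quantum_pos, pow_pos (two_pos : (0 : ℚ) < 2) t,
        pow_pos (two_pos : (0 : ℚ) < 2) (k + 1)]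
    have h2' := lt_of_le_of_lt h1' hltM
    exact_mod_cast lt_of_mul_lt_mul_right h2' φ.quantum_pos.le
  obtain ⟨w, hw'⟩ : ∃ w, k + 1 + d - δ = w := ⟨_, rfl⟩
  have hw1 : 1 ≤ w := by omega
  have hψm : (c + 1) * 2 ^ (k + 1 + d) ≤ 2 ^ (ψ.manBits + 1 + w) := by
    rw [show ψ.manBits + 1 + w = (φ.manBits + 1) + (k + 1 + d) by omega,
      pow_add 2 (φ.manBits + 1) (k + 1 + d)]
    exact Nat.mul_le_mul_right _ hchi
  have hψM : (c + 1) * 2 ^ (k + 1 + d) ≤ ψ.maxScaled :=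
    calc (c + 1) * 2 ^ (k + 1 + d) = (c + 1) * 2 ^ (k + 1) * 2 ^ d := by
          rw [pow_add 2 (k + 1) d, mul_assoc]
      _ ≤ φ.maxScaled * 2 ^ d := Nat.mul_le_mul_right _ hcM
      _ ≤ ψ.maxScaled := hMM
  have hψe : 1 ≤ w → 2 ^ (ψ.manBits + w) ≤ c * 2 ^ (k + 1 + d) := fun _ => by
    rw [show ψ.manBits + w = φ.manBits + (k + 1 + d) by omega, pow_add 2 φ.manBits (k + 1 + d)]
    exact Nat.mul_le_mul_right _ hclo
  have hwin := fine_normal_window_of_roundNE_roundNE_ne hd h1 h1ψ (t := t) (k := k) (w := w)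
    (g := G - ψ.manBits - 1) (c := c) (r := r) (by omega) (by omega) (by omega) hrK hclo hchi
    hcM hψm hψM hψe hne'
  simp only [show (w + 1 ≤ k + d) ↔ (φ.manBits + 1 + 1 ≤ ψ.manBits) from
    ⟨fun h => by omega, fun h => by omega⟩] at hwin
  have hAt := mulFineWinAt_of_window (T := φ.manBits + 1 + 1 ≤ ψ.manBits) hKcr' hrK hwin
  have := mulFineHit_of_far (P := φ.manBits + 1) (mψ := ψ.manBits) (d := d') hoa hoa' hob
    hob' hGP hGle hGlt hGψ
    (by rw [show G - (φ.manBits + 1 - 1) = t by omega]; exact hAt)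
  rw [hhit] at this
  exact Bool.false_ne_true this

/-! ## §2 The law: `(P, P_ψ) = (3, 5)` from `d = 4` on -/

/-- LAW P1 — for EVERY pair of records with `F_φ ⊆ F_ψ`, `m_φ = 2`, `m_ψ = 4` and
`L_ψ + 4 ≤ L_φ`: `DRMul φ ψ` (no range hypothesis). [this packet] -/
theorem drMul_fine_three_five {φ ψ : Format} (hE : embedsTest φ ψ = true)
    (hm : φ.manBits = 2) (hmψ : ψ.manBits = 4) (hq : ψ.qexp + 4 ≤ φ.qexp) : DRMul φ ψ := by
  refine drMul_of_mulFineHit_eq_false hE (by omega) (by omega) (by omega) (by omega) ?_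
  rw [hm, hmψ]
  exact mulFineHit_three_four _ (by omega)

/-! ## §3 The decision of the fine strip -/

/-- THE DECISION OF THE FINE STRIP — for EVERY pair of records with `F_φ ⊆ F_ψ`, `m = m_φ ≥ 1`,
`m + 1 ≤ m_ψ ≤ 2m`, `L_ψ + 1 ≤ L_φ`, depth `m + 3 ≤ bias_φ`, headroom `2^(m + bias_φ + 1) ≤ M_φ`
and `1 ≤ bias_ψ`:  `DRMul φ ψ ↔ m_φ = 2 ∧ m_ψ = 4 ∧ L_ψ + 4 ≤ L_φ`. [this packet] -/
theorem drMul_fine_strip_iff {φ ψ : Format} (hE : embedsTest φ ψ = true) (h1 : 1 ≤ φ.manBits)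
    (hP : φ.manBits + 1 ≤ ψ.manBits) (hP2 : ψ.manBits ≤ 2 * φ.manBits)
    (hq : ψ.qexp + 1 ≤ φ.qexp) (hβ : φ.manBits + 3 ≤ φ.bias)
    (hR : 2 ^ (φ.manBits + φ.bias + 1) ≤ φ.maxScaled) (hb' : 1 ≤ ψ.bias) :
    DRMul φ ψ ↔ (φ.manBits = 2 ∧ ψ.manBits = 4 ∧ ψ.qexp + 4 ≤ φ.qexp) := by
  refine ⟨fun hD => ?_, fun ⟨hm, hmψ, hq4⟩ => drMul_fine_three_five hE hm hmψ hq4⟩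
  have hE' := hE
  simp only [embedsTest, Bool.and_eq_true, decide_eq_true_eq] at hE'
  obtain ⟨⟨-, hq'⟩, hMM⟩ := hE'
  obtain ⟨d, hd'⟩ : ∃ d, (φ.qexp - ψ.qexp).toNat = d := ⟨_, rfl⟩
  have hd1 : 1 ≤ d := by omega
  have hMd : 2 ^ (φ.manBits + φ.bias + 1 + d) ≤ ψ.maxScaled := by
    rw [pow_add]; rw [hd'] at hMM; exact le_trans (Nat.mul_le_mul_right _ hR) hMM
  by_cases h3 : 3 ≤ φ.manBits
  · exact absurd hD (not_drMul_strip hq' hMM h3 (by omega) hP2 (by omega) hb' hR)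
  by_cases hdm : d ≤ φ.manBits + 1
  · refine absurd hD (not_drMul_of_underflow hq (by omega) h1 (α := φ.bias - φ.manBits - 3)
      (β := 0) (by omega) ?_ ?_ ?_)
    · calc (2 ^ (φ.manBits + 1) - 1) * 2 ^ (φ.bias - φ.manBits - 3)
          ≤ 2 ^ (φ.manBits + 1) * 2 ^ (φ.bias - φ.manBits - 3) :=
            Nat.mul_le_mul_right _ (Nat.sub_le _ _)
        _ = 2 ^ (φ.manBits + 1 + (φ.bias - φ.manBits - 3)) := (pow_add _ _ _).symm
        _ ≤ 2 ^ (φ.manBits + φ.bias + 1) := Nat.pow_le_pow_right (by norm_num) (by omega)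
        _ ≤ φ.maxScaled := hR
    · calc (2 ^ φ.manBits + 1) * 2 ^ 0 = 2 ^ φ.manBits + 1 := by rw [pow_zero, mul_one]
        _ ≤ 2 ^ φ.manBits + 2 ^ φ.manBits := by have := Nat.one_le_two_pow (n := φ.manBits); omega
        _ = 2 ^ (φ.manBits + 1) := by rw [pow_succ]; ring
        _ ≤ 2 ^ (φ.manBits + φ.bias + 1) := Nat.pow_le_pow_right (by norm_num) (by omega)
        _ ≤ φ.maxScaled := hR
    · rw [hd']
      calc 2 ^ (d - 1) ≤ 2 ^ (φ.manBits + φ.bias + 1 + d) :=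
            Nat.pow_le_pow_right (by norm_num) (by omega)
        _ ≤ ψ.maxScaled := hMd
  rcases Nat.lt_or_ge φ.manBits 2 with hm1 | hm2
  · -- `(2, 3)`, `d ≥ 3`: the family (W9)
    refine absurd hD (not_drMul_fine_two_three (by omega) (by omega) (by omega)
      (α := φ.bias - 4) (β := 0) (by omega) ?_ ?_ ?_)
    · calc 3 * 2 ^ (φ.bias - 4) ≤ 2 ^ 2 * 2 ^ (φ.bias - 4) := Nat.mul_le_mul_right _ (by norm_num)
        _ = 2 ^ (2 + (φ.bias - 4)) := (pow_add _ _ _).symm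
        _ ≤ 2 ^ (φ.manBits + φ.bias + 1) := Nat.pow_le_pow_right (by norm_num) (by omega)
        _ ≤ φ.maxScaled := hR
    · calc 3 * 2 ^ 0 ≤ 2 ^ 2 := by norm_num
        _ ≤ 2 ^ (φ.manBits + φ.bias + 1) := Nat.pow_le_pow_right (by norm_num) (by omega)
        _ ≤ φ.maxScaled := hR
    · rw [hd']
      calc 5 * 2 ^ (d - 3) ≤ 2 ^ 3 * 2 ^ (d - 3) := Nat.mul_le_mul_right _ (by norm_num)
        _ = 2 ^ (3 + (d - 3)) := (pow_add _ _ _).symm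
        _ ≤ 2 ^ (φ.manBits + φ.bias + 1 + d) := Nat.pow_le_pow_right (by norm_num) (by omega)
        _ ≤ ψ.maxScaled := hMd
  have hm : φ.manBits = 2 := by omega
  rcases Nat.lt_or_ge ψ.manBits 4 with hmψ3 | hmψ4
  · -- `(3, 4)`, `d ≥ 2`: the family (W21)
    refine absurd hD (not_drMul_fine_three_four (by omega) hm (by omega)
      (α := φ.bias - 2) (β := 0) (by omega) ?_ ?_ ?_)
    · calc 3 * 2 ^ (φ.bias - 2) ≤ 2 ^ 2 * 2 ^ (φ.bias - 2) := Nat.mul_le_mul_right _ (by norm_num)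
        _ = 2 ^ (2 + (φ.bias - 2)) := (pow_add _ _ _).symm
        _ ≤ 2 ^ (φ.manBits + φ.bias + 1) := Nat.pow_le_pow_right (by norm_num) (by omega)
        _ ≤ φ.maxScaled := hR
    · calc 7 * 2 ^ 0 ≤ 2 ^ 3 := by norm_num
        _ ≤ 2 ^ (φ.manBits + φ.bias + 1) := Nat.pow_le_pow_right (by norm_num) (by omega)
        _ ≤ φ.maxScaled := hR
    · rw [hd']
      calc 11 * 2 ^ (d - 2) ≤ 2 ^ 4 * 2 ^ (d - 2) := Nat.mul_le_mul_right _ (by norm_num)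
        _ = 2 ^ (4 + (d - 2)) := (pow_add _ _ _).symm
        _ ≤ 2 ^ (φ.manBits + φ.bias + 1 + d) := Nat.pow_le_pow_right (by norm_num) (by omega)
        _ ≤ ψ.maxScaled := hMd
  exact ⟨hm, by omega, by omega⟩

end Summit.Ventures.CertifiedArithmetic
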